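import Summits.Parity.BatemanHorn.Theses.RatioProfile

/-!
# Line `birth` — elaborating skeleton for the crux `UltraLogConcave`
(item stmt-Parity-10065, route `RatioProfile` = route-Parity-RatioProfile, sub-problem `BatemanHorn`)

Crux (by name, concluded by `UltraLogConcave_of` below — hypothesis form, real proof — and instantiated on
the stubs by `UltraLogConcave_of_stubs`):
`Summit.Parity.BatemanHorn.Theses.RatioProfile.UltraLogConcave` — for every Bateman–Horn system
`f = (f₁,…,f_k)`, `k ≥ 1`, eventually in `x`, for `1 ≤ j ≤ 2L(x)` (`L(x) = k·loglog x + log ∏ deg fᵢ`):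
`π_x(k+j−1) > 0`, `π_x(k+j) > 0` and `(j+1)·π_x(k+j−1)·π_x(k+j+1) ≤ j·π_x(k+j)²`, where
`π_x(j) = #{1 ≤ n ≤ x : ω(|∏ fᵢ(n)|) = j}` is the almost-prime histogram; equivalently the
likelihood-ratio profile `r_j(x) := j·π_x(k+j)/π_x(k+j−1)` is non-increasing from the prime cell
through the bulk.

## The line: MODEL-PROFILE TRANSFER, cut at the boundary layer

Write `g_x(u) := (log (Λ_x(u)/Γ(1+u)^k))′ = Σ_{p ≤ x} [ρ(p)/(p + (u−1)ρ(p)) + k·log(1 − 1/p)] − k·ψ(1+u)`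
for the derivative of the log of the route's model profile (`Λ_x` as in `BulkIncrementLaw`; `g_x(0) + kγ`
is exactly the centring of `BoundaryRatioLaw`). The Kubilius/LSD model predicts
`r_j(x) = L + g_x(j/L) + (smooth in j/L)/L + O(1/L²)`, hence INCREMENTS
`r_{j+1} − r_j = g_x((j+1)/L) − g_x(j/L) + O(1/L²)`, while `g_x` is strictly decreasing with slope
`≤ −k·ψ′(4) < 0` on `[0, 3]`. ULC is the sign of the increment; the skeleton isolates

* `stub_cellsPositive` (P) — every cell `k ≤ m ≤ k + 2L(x)` is non-empty for large `x` (the crux's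
  positivity conjuncts; at `m = k` this is the qualitative Schinzel/Bouniakowsky-type statement
  "ω(|∏ fᵢ(n)|) = k for some n ≤ x, all large x" — open for `deg ≥ 2`; the cells `m ≥ k+1` are
  almost-prime cells, sieve-accessible). Needed to clear denominators; implied by the crux.
* `stub_ratioIncrementBoundary` (R_bd) — the ONE-SIDED increment law with `o(1/L)` slack on a boundary
  layer `1 ≤ j ≤ δL` for SOME `δ > 0`: `r_{j+1} − r_j ≤ g_x((j+1)/L) − g_x(j/L) + ε/L`. This is the
  parity-hard half (route header, TWO-LAYER PLAN: "boundary range 1 ≤ j ≤ δL, parity-hard"): it reads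
  the prime-tuple cell `π_x(k)` and its two neighbours to relative precision `o(1/L²)` (one-sidedly),
  i.e. the `z → 0` end of `M_x(z) = Σ_n z^{ω(P(n))}`.
* `stub_ratioIncrementBulk` (R_bk) — the same one-sided increment law on the bulk `δL ≤ j ≤ 2L` for
  EVERY `δ > 0`: the `|z| ∈ [δ′, 2⁺]` regime of `M_x(z)` (second-order LSD / local Erdős–Kac along the
  system, in DIFFERENCED form — cf. crux `SystemLSDRealSegment` of route AlmostPrimeZeros for the
  first-order real-segment law). For `f = (X)` both R-stubs follow from the in-tree Selberg–Delange
  theorem (main term uniform in `|z| ≤ R`, error `O(x (log x)^{Re z − 2})` = relative `e^{−L}`, far below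
  `1/L²`: `Literature.NumberTheory.LFunctions.MontgomeryVaughan2007_thm_7_18_holds` with
  `omegaMeanValue_of_thm_7_18`) by Cauchy coefficient extraction = the tilted-symbol algebra of crux idea
  `linear-rung-tilted-symbol` (evidence on stmt-Parity-10065): `[z^j](e^{zL}λ(z)) = (L^j/j!)·τ_L(j)`,
  `τ_L(j) = λ(j/L) − (j/L)·λ″(j/L)/(2L) + O(1/L²)` smooth in `j/L`.
* `stub_profileDecrease` (G) — pure special-function analysis, provable now (M): `∃ c > 0`, eventually in
  `x`, `g_x(v) − g_x(u) ≤ −c(v−u)` for `0 ≤ u ≤ v ≤ 3` (each prime term `ρ/(p+(u−1)ρ)` is non-increasing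
  in `u` since `ρ(p) < p`; `ψ′(1+u) ≥ ψ′(4) > 0.28` on `[0,3]`; `c = k·ψ′(4)` works for all `x`).

Composition (`UltraLogConcave_of`, sorry-free): eventually `L(x) ≥ 1`; for `1 ≤ j ≤ 2L` pick the boundary or
bulk increment bound according to `j ≤ δL` or `δL ≤ j`, with `ε = c/2`; (G) at `u = j/L`, `v = (j+1)/L ≤ 3`
gives `r_{j+1} − r_j ≤ −c/L + (c/2)/L < 0`; (P) makes `π_x(k+j−1), π_x(k+j) > 0`, and clearing the two
denominators turns `r_{j+1} < r_j` into `(j+1)·π_x(k+j−1)·π_x(k+j+1) ≤ j·π_x(k+j)²`.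

Why this cut and not another: (i) the Poisson factor `L^j/j!` of the model is ULC-NEUTRAL (equality in
Newton), so the whole margin `≍ 1/L` of the crux comes from the strict log-concavity of `Λ_x/Γ(1+·)^k` — (G)
names and isolates exactly that margin; (ii) the increment form is the currency in which every analytic
method (LSD + saddle point, tilted symbol, Poisson-convolution model) delivers local laws, and it is weaker
than a two-sided cell-by-cell law to relative `o(1/L²)`; (iii) the boundary/bulk cut is the route's own
foreseen split of this crux. No stub is the crux or the summit in costume: (P) is qualitative, (G) is
analysis, (R_bd)/(R_bk) are range-restricted one-sided increment bounds against an explicit profile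
(BC3 probes, 2026-08-17: `example : Stub → UltraLogConcave` and `example : Stub → _root_.BatemanHorn` by
`first | exact? | simpa | aesop` under `maxHeartbeats 400000` FAIL 8/8 — "unsolved goals", aesop
"failed to prove the goal after exhaustive search" — and FAIL 8/8 again with the stub's and the target's
definitions unfolded first; probe files `bc/probesA.lean`, `bc/probesB.lean` in the registrar's folder).

Disproof used: none on file for this crux (`ledger crux ls stmt-Parity-10065`: no workfiles at registration).
Negatives index (`ledger negatives --problem Parity`, 2026-08-17: 3 refuted statements, all on the
GeneralizedHardyLittlewood side — stmt-Parity-9541 sieve-sequence convolution moments, stmt-Parity-14832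
inverse-sieve tuples, stmt-Parity-4218 shifted-multiplication-table rectangle Chowla): unrelated to
histograms of `ω` along a polynomial system; no stub restates one.
`lean check`: rc 0; `sorry` exactly in the four `stub_*` theorems (sorries = 4 = stubs, zero elsewhere);
`#print axioms UltraLogConcave_of` = [propext, Classical.choice, Quot.sound]; `ultraLogConcave_iff_parts`
certifies (by `Iff.rfl`) that the `hist`/`Lfun` spelling below is the crux's `let π / let L` spelling.
-/

namespace Summit.Parity.BatemanHorn.Cruxes.UltraLogConcave.Birth

open Filter Finset Polynomial
open Literature.NumberTheory.Sieve
open Summit.Parity.BatemanHorn.Theses.RatioProfile (UltraLogConcave)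
open scoped BigOperators Topology Classical

noncomputable section

/-! ### Objects of the line (verbatim the crux's `let`-bound quantities, plus the model profile) -/

/-- The almost-prime histogram `π_x(j) := #{1 ≤ n ≤ x : ω(|∏ᵢ fᵢ(n)|) = j}` (the crux's `let π`). -/
def hist {k : ℕ} (f : Fin k → ℤ[X]) (x j : ℕ) : ℕ :=
  ((Finset.Icc 1 x).filter (fun n : ℕ =>
    ArithmeticFunction.cardDistinctFactors (∏ i, (f i).eval (n : ℤ)).natAbs = j)).card

/-- `L(x) := k·loglog x + log ∏ᵢ deg fᵢ` (the crux's `let L`). -/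
def Lfun {k : ℕ} (f : Fin k → ℤ[X]) (x : ℕ) : ℝ :=
  (k : ℝ) * Real.log (Real.log (x : ℝ)) + Real.log (∏ i, ((f i).natDegree : ℝ))

/-- The likelihood-ratio profile `r_j(x) := j·π_x(k+j)/π_x(k+j−1)` as a real number
(junk `0` when the lower cell is empty; only used where (P) makes it honest). -/
def ratio {k : ℕ} (f : Fin k → ℤ[X]) (x j : ℕ) : ℝ :=
  (j : ℝ) * (hist f x (k + j) : ℝ) / (hist f x (k + j - 1) : ℝ)

/-- The model profile derivative `g_x(u) := (log (Λ_x(u)/Γ(1+u)^k))′ =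
Σ_{p ≤ x} [ρ(p)/(p + (u−1)ρ(p)) + k·log(1 − 1/p)] − k·ψ(1+u)`, with `ρ = polyRootCountMod f`,
`Λ_x(u) = ∏_{p ≤ x}(1 + (u−1)ρ(p)/p)(1 − 1/p)^{k(u−1)}` the route's model (`BulkIncrementLaw`) and
`ψ = Γ′/Γ` (real part of `Complex.digamma` on the real axis). `g_x(0) + kγ` is the centring of
`BoundaryRatioLaw`. -/
def gprof {k : ℕ} (f : Fin k → ℤ[X]) (x : ℕ) (u : ℝ) : ℝ :=
  (∑ p ∈ Nat.primesLE x,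
      ((polyRootCountMod f p : ℝ) / ((p : ℝ) + (u - 1) * (polyRootCountMod f p : ℝ))
        + (k : ℝ) * Real.log (1 - 1 / (p : ℝ))))
    - (k : ℝ) * (Complex.digamma (1 + (u : ℂ))).re

/-! ### The four stub statements -/

/-- (P) Cells `k, k+1, …, k+⌊2L(x)⌋` of the histogram are non-empty for all large `x`. -/
def CellsPositive (k : ℕ) (f : Fin k → ℤ[X]) : Prop :=
  ∀ᶠ x : ℕ in atTop, ∀ j : ℕ, (j : ℝ) ≤ 2 * Lfun f x → 0 < hist f x (k + j)

/-- (R_bd) One-sided increment law on a boundary layer: for some `δ > 0` and every `ε > 0`, eventually,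
`r_{j+1}(x) − r_j(x) ≤ g_x((j+1)/L) − g_x(j/L) + ε/L` for `1 ≤ j ≤ δ·L(x)`. -/
def RatioIncrementBoundary (k : ℕ) (f : Fin k → ℤ[X]) : Prop :=
  ∃ δ : ℝ, 0 < δ ∧ ∀ ε : ℝ, 0 < ε → ∀ᶠ x : ℕ in atTop, ∀ j : ℕ, 1 ≤ j → (j : ℝ) ≤ δ * Lfun f x →
    ratio f x (j + 1) - ratio f x j ≤
      gprof f x (((j : ℝ) + 1) / Lfun f x) - gprof f x ((j : ℝ) / Lfun f x) + ε / Lfun f x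

/-- (R_bk) One-sided increment law in the bulk: for every `δ > 0` and `ε > 0`, eventually,
`r_{j+1}(x) − r_j(x) ≤ g_x((j+1)/L) − g_x(j/L) + ε/L` for `δ·L(x) ≤ j ≤ 2·L(x)` (`j ≥ 1`). -/
def RatioIncrementBulk (k : ℕ) (f : Fin k → ℤ[X]) : Prop :=
  ∀ δ : ℝ, 0 < δ → ∀ ε : ℝ, 0 < ε → ∀ᶠ x : ℕ in atTop, ∀ j : ℕ, 1 ≤ j →
    δ * Lfun f x ≤ (j : ℝ) → (j : ℝ) ≤ 2 * Lfun f x →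
      ratio f x (j + 1) - ratio f x j ≤
        gprof f x (((j : ℝ) + 1) / Lfun f x) - gprof f x ((j : ℝ) / Lfun f x) + ε / Lfun f x

/-- (G) The model profile derivative is strictly decreasing on `[0, 3]` with a uniform modulus:
`∃ c > 0`, eventually in `x`, `g_x(v) − g_x(u) ≤ −c·(v − u)` for `0 ≤ u ≤ v ≤ 3`. -/
def ProfileDecrease (k : ℕ) (f : Fin k → ℤ[X]) : Prop :=
  ∃ c : ℝ, 0 < c ∧ ∀ᶠ x : ℕ in atTop, ∀ u v : ℝ, 0 ≤ u → u ≤ v → v ≤ 3 →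
    gprof f x v - gprof f x u ≤ -c * (v - u)

/-! ### The registered stubs (the ONLY places `sorry` occurs) -/

/-- **Stub (P): non-empty cells through the bulk.** For every Bateman–Horn system with `k ≥ 1`,
eventually every cell `k ≤ m ≤ k + 2L(x)` of the almost-prime histogram is non-empty. At `m = k` this is
"some `n ≤ x` has `ω(|∏ fᵢ(n)|) = k`" for all large `x` (qualitative Schinzel-type, open for `deg ≥ 2`,
implied by `BatemanHorn` + `BottomCell`); for `m ≥ k+1` the cells are almost-prime cells (CRT placement of
`m − r` small prime divisors + a weighted lower-bound sieve on the cofactor; exactness of `ω` is the delicate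
point). Size: L (open at `m = k`). Sources: BatemanHornMathComp1962, HalberstamRichert1974,
IwaniecInventiones1978, doi:10.5802/aif.1213. -/
theorem stub_cellsPositive :
    ∀ (k : ℕ) (f : Fin k → ℤ[X]), IsBatemanHornSystem f → 0 < k → CellsPositive k f := by
  sorry

/-- **Stub (R_bd): one-sided ratio-increment law on a boundary layer.** For every system there is
`δ > 0` such that for every `ε > 0`, eventually in `x`, `r_{j+1} − r_j ≤ g_x((j+1)/L) − g_x(j/L) + ε/L`
for `1 ≤ j ≤ δL(x)`. Model: `r_j = L + g_x(j/L) + h_x(j/L)/L + O(1/L²)` with `h_x` equi-Lipschitz, so the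
increment error is `O(1/L²)`; at `j = 1, 2` it reads `π_x(k)`, `π_x(k+1)`, `π_x(k+2)` jointly to relative
`o(1/L²)` — beyond the leading term of Bateman–Horn (parity-hard; the `z → 0` end of `Σ_n z^{ω(P(n))}`).
For `f = (X)`: provable now from the in-tree Selberg–Delange main term, uniform in `|z| ≤ 3`
(`MontgomeryVaughan2007_thm_7_18_holds`, `omegaMeanValue_of_thm_7_18`), by Cauchy extraction on
`|z| = j/L` + the tilted-symbol expansion. Size: open (crux-hard) in general; L for `f = (X)`.
Sources: Selberg1954, Tenenbaum2015 (II.6), HallTenenbaum1988, doi:10.5802/aif.1213,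
BatemanHornMathComp1962, MontgomeryVaughan2007 (Thm 7.18). -/
theorem stub_ratioIncrementBoundary :
    ∀ (k : ℕ) (f : Fin k → ℤ[X]), IsBatemanHornSystem f → 0 < k → RatioIncrementBoundary k f := by
  sorry

/-- **Stub (R_bk): one-sided ratio-increment law in the bulk.** For every system, every `δ > 0` and
`ε > 0`, eventually in `x`, `r_{j+1} − r_j ≤ g_x((j+1)/L) − g_x(j/L) + ε/L` for `δL(x) ≤ j ≤ 2L(x)`:
the differenced second-order local law for `ω(∏ fᵢ(n))` in the regime `|z| ∈ [δ′, 2⁺]` of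
`M_x(z) = Σ_{n ≤ x} z^{ω(P(n))}` (LSD in a complex neighbourhood of the real segment + saddle point; cf. crux
`SystemLSDRealSegment`, route AlmostPrimeZeros, for the first-order segment law). Destroyed cell-by-cell by
Selberg's twin measures `1 ± λ(P(n))` for sieve methods (SelbergParityBarrier, conceded by the route); the
one-sided differenced form is the weakest version the crux needs. For `f = (X)`: provable now as for (R_bd).
Size: open. Sources: Selberg1954, Tenenbaum2015 (II.6.1), NairTenenbaum1998, HallTenenbaum1988,
arXiv:math/0603647. -/
theorem stub_ratioIncrementBulk :
    ∀ (k : ℕ) (f : Fin k → ℤ[X]), IsBatemanHornSystem f → 0 < k → RatioIncrementBulk k f := by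
  sorry

/-- **Stub (G): strict decrease of the model profile derivative.** For every system with `k ≥ 1` there is
`c > 0` with `g_x(v) − g_x(u) ≤ −c(v − u)` for `0 ≤ u ≤ v ≤ 3` and all large `x` (in fact all `x`, with
`c = k·ψ′(4) = k(π²/6 − 49/36) > 0.28k`): each prime term `ρ(p)/(p + (u−1)ρ(p))` is non-increasing in
`u ≥ 0` because `ρ(p) < p` (`IsBatemanHornSystem.hasNoFixedPrimeDivisor`), and `u ↦ Re ψ(1+u)` has
derivative `ψ′(1+u) = Σ_{n ≥ 0} (n+1+u)⁻² ≥ ψ′(4)` on `[0,3]` (series for `Complex.digamma`,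
`Literature.Analysis.SpecialFunctions.DigammaGauss.hasSum_one_div_sub_one_div_digamma`). Provable now.
Size: M. Sources: Tenenbaum2015 (II.6, the function `λ(z)`), BrandenHuh2019 (log-concavity bookkeeping). -/
theorem stub_profileDecrease :
    ∀ (k : ℕ) (f : Fin k → ℤ[X]), IsBatemanHornSystem f → 0 < k → ProfileDecrease k f := by
  sorry

/-! ### Sorry-free glue -/

/-- The `hist`/`Lfun` spelling of the crux is definitionally the route's `let π / let L` spelling. [folklore] -/
theorem ultraLogConcave_iff_parts :
    UltraLogConcave ↔
      ∀ (k : ℕ) (f : Fin k → ℤ[X]), IsBatemanHornSystem f → 0 < k →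
        ∀ᶠ x : ℕ in atTop, ∀ j : ℕ, 1 ≤ j → (j : ℝ) ≤ 2 * Lfun f x →
          0 < hist f x (k + j - 1) ∧ 0 < hist f x (k + j) ∧
            ((j : ℝ) + 1) * (hist f x (k + j - 1) : ℝ) * (hist f x (k + j + 1) : ℝ) ≤
              (j : ℝ) * (hist f x (k + j) : ℝ) ^ 2 :=
  Iff.rfl

/-- `L(x) → ∞`; in particular `L(x) ≥ 1` eventually (`k ≥ 1`). [folklore] -/
theorem tendsto_Lfun_atTop {k : ℕ} (f : Fin k → ℤ[X]) (hk : 0 < k) :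
    Tendsto (fun x : ℕ => Lfun f x) atTop atTop := by
  have h1 : Tendsto (fun x : ℕ => Real.log (Real.log (x : ℝ))) atTop atTop :=
    (Real.tendsto_log_atTop.comp Real.tendsto_log_atTop).comp tendsto_natCast_atTop_atTop
  have h2 : Tendsto (fun x : ℕ => (k : ℝ) * Real.log (Real.log (x : ℝ))) atTop atTop :=
    h1.const_mul_atTop (by exact_mod_cast hk)
  exact tendsto_atTop_add_const_right _ _ h2

/-- From a strict ratio decrease `r_{j+1} < r_j` over positive cells to the crux's cell inequality. [folklore] -/
theorem cell_ineq_of_ratio_lt {k : ℕ} (f : Fin k → ℤ[X]) (x j : ℕ)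
    (hp1 : 0 < hist f x (k + j - 1)) (hp2 : 0 < hist f x (k + j))
    (hlt : ratio f x (j + 1) < ratio f x j) :
    ((j : ℝ) + 1) * (hist f x (k + j - 1) : ℝ) * (hist f x (k + j + 1) : ℝ) ≤
      (j : ℝ) * (hist f x (k + j) : ℝ) ^ 2 := by
  unfold ratio at hlt
  have e1 : k + (j + 1) - 1 = k + j := by omega
  have e2 : k + (j + 1) = k + j + 1 := by omega
  rw [e1, e2] at hlt
  push_cast at hlt
  have hq1 : (0 : ℝ) < (hist f x (k + j - 1) : ℝ) := by exact_mod_cast hp1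
  have hq2 : (0 : ℝ) < (hist f x (k + j) : ℝ) := by exact_mod_cast hp2
  rw [div_lt_div_iff₀ hq2 hq1] at hlt
  calc ((j : ℝ) + 1) * (hist f x (k + j - 1) : ℝ) * (hist f x (k + j + 1) : ℝ)
      = ((j : ℝ) + 1) * (hist f x (k + j + 1) : ℝ) * (hist f x (k + j - 1) : ℝ) := by ring
    _ ≤ (j : ℝ) * (hist f x (k + j) : ℝ) * (hist f x (k + j) : ℝ) := hlt.le
    _ = (j : ℝ) * (hist f x (k + j) : ℝ) ^ 2 := by ring

/-- **THE SKELETON THEOREM (hypothesis form, real proof).** The four stub statements prove the crux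
`Summit.Parity.BatemanHorn.Theses.RatioProfile.UltraLogConcave` BY NAME. [folklore] -/
theorem UltraLogConcave_of :
    (∀ (k : ℕ) (f : Fin k → ℤ[X]), IsBatemanHornSystem f → 0 < k → CellsPositive k f) →
    (∀ (k : ℕ) (f : Fin k → ℤ[X]), IsBatemanHornSystem f → 0 < k → RatioIncrementBoundary k f) →
    (∀ (k : ℕ) (f : Fin k → ℤ[X]), IsBatemanHornSystem f → 0 < k → RatioIncrementBulk k f) →
    (∀ (k : ℕ) (f : Fin k → ℤ[X]), IsBatemanHornSystem f → 0 < k → ProfileDecrease k f) →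
      UltraLogConcave := by
  intro hP hRb hRk hG
  rw [ultraLogConcave_iff_parts]
  intro k f hf hk
  obtain ⟨δ, hδ, hRb'⟩ := hRb k f hf hk
  obtain ⟨c, hc, hG'⟩ := hG k f hf hk
  have hc2 : 0 < c / 2 := by positivity
  have hPx := hP k f hf hk
  have hBx := hRb' (c / 2) hc2
  have hKx := hRk k f hf hk δ hδ (c / 2) hc2
  have hLx := (tendsto_Lfun_atTop f hk).eventually_ge_atTop 1
  filter_upwards [hPx, hBx, hKx, hG', hLx] with x hP1 hB1 hK1 hG1 hL1
  intro j hj1 hj2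
  have hL0 : 0 < Lfun f x := by linarith
  -- positivity of the two cells entering the denominators
  have pos1 : 0 < hist f x (k + j - 1) := by
    have hcast : ((j - 1 : ℕ) : ℝ) = (j : ℝ) - 1 := by
      rw [Nat.cast_sub hj1]; simp
    have hle : ((j - 1 : ℕ) : ℝ) ≤ 2 * Lfun f x := by rw [hcast]; linarith
    have h := hP1 (j - 1) hle
    have e : k + (j - 1) = k + j - 1 := by omega
    rw [e] at h
    exact h
  have pos2 : 0 < hist f x (k + j) := hP1 j hj2
  refine ⟨pos1, pos2, ?_⟩
  -- the one-sided increment bound at j (boundary or bulk)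
  have hincr : ratio f x (j + 1) - ratio f x j ≤
      gprof f x (((j : ℝ) + 1) / Lfun f x) - gprof f x ((j : ℝ) / Lfun f x) + (c / 2) / Lfun f x := by
    rcases le_total (j : ℝ) (δ * Lfun f x) with h | h
    · exact hB1 j hj1 h
    · exact hK1 j hj1 h hj2
  -- the model profile decreases by at least c/L between j/L and (j+1)/L
  have hu0 : (0 : ℝ) ≤ (j : ℝ) / Lfun f x := by positivity
  have huv : (j : ℝ) / Lfun f x ≤ ((j : ℝ) + 1) / Lfun f x := by
    gcongr
    linarith
  have hv3 : ((j : ℝ) + 1) / Lfun f x ≤ 3 := by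
    rw [div_le_iff₀ hL0]
    linarith
  have hg := hG1 _ _ hu0 huv hv3
  have hdiff : ((j : ℝ) + 1) / Lfun f x - (j : ℝ) / Lfun f x = 1 / Lfun f x := by
    rw [div_sub_div_same, add_sub_cancel_left]
  rw [hdiff] at hg
  -- hence a strict ratio decrease
  have hneg : -c * (1 / Lfun f x) + (c / 2) / Lfun f x < 0 := by
    have : -c * (1 / Lfun f x) + (c / 2) / Lfun f x = -(c / 2) / Lfun f x := by
      field_simp
      ring
    rw [this]
    exact div_neg_of_neg_of_pos (by linarith) hL0
  have hlt : ratio f x (j + 1) < ratio f x j := by linarith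
  exact cell_ineq_of_ratio_lt f x j pos1 pos2 hlt

/-- **The crux BY NAME from the four registered stubs.** [folklore] -/
theorem UltraLogConcave_of_stubs : UltraLogConcave :=
  UltraLogConcave_of stub_cellsPositive stub_ratioIncrementBoundary stub_ratioIncrementBulk
    stub_profileDecrease

end

end Summit.Parity.BatemanHorn.Cruxes.UltraLogConcave.Birth
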